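import Summits.CriticalPhenomena.CardyFormulaZ2.Theorems.CardyQContinuationFirstJetAtOneBounded
import Summits.CriticalPhenomena.CardyFormulaZ2.Theorems.CardyQContinuationPivotalCancellationAtOneJets
import Literature.Probability.LatticeModels.IndependencePolynomialProofs

/-!
# The crossing-odds cone in an explicit sector (crux `UniformZeroFree`, stmt-CriticalPhenomena-5559)

Quantitative form of the pointwise envelope `oddsCone_pointwise`
(`Theorems/CardyQContinuationUniformZeroFreeOddsConeEnvelope.lean`, sibling file, not imported) of
the registered stub
`stub_oddsCone` (line `birth`): the TRIVIAL mechanism and its rate.  With the route's notation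
(`Z_δ`, `N_δ`, `N'_δ = Z_δ − N_δ`, weights `s^{L(ω)}`, `L(ω) = |ω| + 2 k_B(ω)`), both `N'_δ` and
`N_δ` are polynomials in `s` with non-negative coefficients and degree `≤ D_δ := |E(Ω_δ)| + 2|V(Ω_δ)|`.
For `|arg s| · D_δ ≤ π/2` every cross term `s^p · conj(s^q) = |s|^{p+q} e^{i(p−q) arg s}` has
non-negative real part, so `Re(N'_δ(s) · conj N_δ(s)) ≥ 0` and the cone inequality holds with any
`κ ≥ 0` — on the thickening of `[1, √2]` of radius `ρ_δ = 1 / (4 (D_δ + 1))`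
(`oddsCone_sector`; the step `|arg s| ≤ |Im s|/Re s` is the tree's
`PetersRegts.abs_arg_le_abs_im_div_re`).  Since `D_δ ≍ area(Ω)/δ²`, the trivial radius is
`ρ_δ ≍ δ²`; the stub asks for `ρ` independent of `δ`, i.e. to beat the degree bound by the full
factor `δ⁻²`.
-/

namespace Summit.CriticalPhenomena.CardyFormulaZ2.Theorems.UniformZeroFree

open Filter Metric Set
open scoped Topology ComplexConjugate Real
open Literature.Probability.LatticeModels Literature.Probability.Percolation
open Literature.Probability.RandomPlanarGeometry
open Summit.CriticalPhenomena.CardyFormulaZ2.Theorems.CardyQContinuation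
open Summit.CriticalPhenomena.CardyFormulaZ2.Theorems (finite_edgeSet_discreteDomainGraph)

noncomputable section

/-- `Σ_F s^{m a} − Σ_F 𝟙_C(a) s^{m a} = Σ_F 𝟙_{Cᶜ}(a) s^{m a}` (copy of the envelope's
`oddsCone_sum_sub_sum_indicator`, kept private so that both files can be imported together).
[folklore] -/
private theorem oddsCone_sum_sub_sum_indicator_aux {α : Type*} (F : Finset α) (C : Set α)
    (m : α → ℕ) (s : ℂ) :
    (∑ a ∈ F, s ^ m a) - (∑ a ∈ F, C.indicator (fun b => s ^ m b) a)
      = ∑ a ∈ F, Cᶜ.indicator (fun b => s ^ m b) a := by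
  rw [← Finset.sum_sub_distrib]
  refine Finset.sum_congr rfl fun a _ => ?_
  by_cases ha : a ∈ C
  · simp [Set.indicator_of_mem ha, Set.indicator_of_notMem (Set.notMem_compl_iff.2 ha)]
  · simp [Set.indicator_of_notMem ha, Set.indicator_of_mem (Set.mem_compl ha)]

/-- De Moivre: `Re((r e^{iθ})^p · conj((r e^{iθ})^q)) = r^{p+q} cos((p − q) θ)`. [folklore] -/
theorem oddsCone_re_polar_pow_mul_conj_pow (r θ : ℝ) (p q : ℕ) :
    (((r : ℂ) * (Complex.cos θ + Complex.sin θ * Complex.I)) ^ p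
        * conj (((r : ℂ) * (Complex.cos θ + Complex.sin θ * Complex.I)) ^ q)).re
      = r ^ (p + q) * Real.cos (((p : ℝ) - q) * θ) := by
  rw [mul_pow, mul_pow, Complex.cos_add_sin_mul_I_pow, Complex.cos_add_sin_mul_I_pow]
  have h1 : (p : ℂ) * θ = ((p * θ : ℝ) : ℂ) := by push_cast; ring
  have h2 : (q : ℂ) * θ = ((q * θ : ℝ) : ℂ) := by push_cast; ring
  rw [h1, h2, ← Complex.ofReal_cos, ← Complex.ofReal_sin, ← Complex.ofReal_cos,
    ← Complex.ofReal_sin, ← Complex.ofReal_pow, ← Complex.ofReal_pow]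
  simp only [map_mul, map_add, Complex.conj_ofReal, Complex.conj_I, Complex.mul_re,
    Complex.mul_im, Complex.add_re, Complex.add_im, Complex.ofReal_re, Complex.ofReal_im,
    Complex.I_re, Complex.I_im, Complex.neg_re, Complex.neg_im]
  rw [show ((p : ℝ) - q) * θ = p * θ - q * θ by ring, Real.cos_sub, pow_add]
  ring

/-- If `p, q ≤ D` and `D · |arg s| ≤ π/2` then `Re(s^p · conj(s^q)) ≥ 0`. [folklore] -/
theorem oddsCone_re_pow_mul_conj_pow_nonneg {s : ℂ} {p q D : ℕ} (hp : p ≤ D) (hq : q ≤ D)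
    (hθ : (D : ℝ) * |Complex.arg s| ≤ π / 2) : 0 ≤ (s ^ p * conj (s ^ q)).re := by
  rw [← Complex.norm_mul_cos_add_sin_mul_I s, oddsCone_re_polar_pow_mul_conj_pow]
  have hpR : (p : ℝ) ≤ D := by exact_mod_cast hp
  have hqR : (q : ℝ) ≤ D := by exact_mod_cast hq
  have hpq : |((p : ℝ) - q)| ≤ D := by
    rw [abs_sub_le_iff]
    constructor <;> linarith [(Nat.cast_nonneg p : (0 : ℝ) ≤ p), (Nat.cast_nonneg q : (0 : ℝ) ≤ q)]
  have key : |((p : ℝ) - q) * Complex.arg s| ≤ π / 2 := by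
    rw [abs_mul]
    exact (mul_le_mul_of_nonneg_right hpq (abs_nonneg _)).trans hθ
  obtain ⟨k1, k2⟩ := abs_le.1 key
  refine mul_nonneg (pow_nonneg (norm_nonneg _) _)
    (Real.cos_nonneg_of_neg_pi_div_two_le_of_le (by linarith) k2)

/-- **Sector positivity.** If all exponents are `≤ D` and `D · |arg s| ≤ π/2` then
`Re((Σ_F 𝟙_{Cᶜ} s^{m}) · conj(Σ_F 𝟙_C s^{m})) ≥ 0` (expand and apply
`oddsCone_re_pow_mul_conj_pow_nonneg` termwise). [folklore] -/
theorem oddsCone_re_sum_compl_mul_conj_sum_nonneg {α : Type*} (F : Finset α) (C : Set α)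
    (m : α → ℕ) {D : ℕ} (hm : ∀ a ∈ F, m a ≤ D) {s : ℂ}
    (hθ : (D : ℝ) * |Complex.arg s| ≤ π / 2) :
    0 ≤ ((∑ a ∈ F, Cᶜ.indicator (fun b => s ^ m b) a)
      * conj (∑ a ∈ F, C.indicator (fun b => s ^ m b) a)).re := by
  rw [map_sum, Finset.sum_mul_sum, Complex.re_sum]
  refine Finset.sum_nonneg fun a ha => ?_
  rw [Complex.re_sum]
  refine Finset.sum_nonneg fun b hb => ?_
  by_cases hac : a ∈ Cᶜ
  · by_cases hbc : b ∈ C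
    · rw [Set.indicator_of_mem hac, Set.indicator_of_mem hbc]
      exact oddsCone_re_pow_mul_conj_pow_nonneg (hm a ha) (hm b hb) hθ
    · simp [Set.indicator_of_notMem hbc]
  · simp [Set.indicator_of_notMem hac]

/-- **The cone in an explicit sector, finite-sum form.** If all exponents are `≤ D`, then for every
`κ ≥ 0` and every complex `s` within `ρ ≤ 1/(4(D+1))` of a real `t ≥ 1`, with
`Z(s) = Σ_F s^{m a}`, `N(s) = Σ_F 𝟙_C(a) s^{m a}`:
`Re((Z − N)(s) · conj N(s)) ≥ 0 ≥ −κ ‖(Z − N)(s)‖ ‖N(s)‖`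
(there `Re s > 3/4`, `|Im s| < ρ`, so `D |arg s| ≤ 4ρD/3 ≤ 1/3 < π/2`). [folklore] -/
theorem oddsCone_sector_finset {α : Type*} (F : Finset α) (C : Set α) (m : α → ℕ) {D : ℕ}
    (hm : ∀ a ∈ F, m a ≤ D) {κ : ℝ} (hκ : 0 ≤ κ) {ρ : ℝ} (hρ : ρ ≤ 1 / (4 * ((D : ℝ) + 1)))
    {s : ℂ} {t : ℝ} (ht : 1 ≤ t) (hst : dist s t < ρ) :
    -(κ * (‖(∑ a ∈ F, s ^ m a) - ∑ a ∈ F, C.indicator (fun b => s ^ m b) a‖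
        * ‖∑ a ∈ F, C.indicator (fun b => s ^ m b) a‖))
      ≤ (((∑ a ∈ F, s ^ m a) - ∑ a ∈ F, C.indicator (fun b => s ^ m b) a)
          * conj (∑ a ∈ F, C.indicator (fun b => s ^ m b) a)).re := by
  rw [oddsCone_sum_sub_sum_indicator_aux]
  refine le_trans (neg_nonpos.2 (mul_nonneg hκ (mul_nonneg (norm_nonneg _) (norm_nonneg _))))
    (oddsCone_re_sum_compl_mul_conj_sum_nonneg F C m hm ?_)
  -- the sector estimate
  have hD : (0 : ℝ) ≤ D := Nat.cast_nonneg D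
  have hD1 : (0 : ℝ) < 4 * ((D : ℝ) + 1) := by positivity
  have hρ4 : ρ ≤ 1 / 4 :=
    hρ.trans (one_div_le_one_div_of_le (by norm_num : (0:ℝ) < 4) (by nlinarith))
  have hre : 3 / 4 < s.re := by
    have h1 : |(s - t).re| ≤ ‖s - (t : ℂ)‖ := Complex.abs_re_le_norm _
    rw [Complex.sub_re, Complex.ofReal_re] at h1
    have h2 : ‖s - (t : ℂ)‖ < ρ := by rwa [← dist_eq_norm]
    have h3 := (abs_lt.1 (h1.trans_lt h2)).1
    linarith
  have him : |s.im| < ρ := by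
    have h1 : |(s - t).im| ≤ ‖s - (t : ℂ)‖ := Complex.abs_im_le_norm _
    rw [Complex.sub_im, Complex.ofReal_im, sub_zero] at h1
    have h2 : ‖s - (t : ℂ)‖ < ρ := by rwa [← dist_eq_norm]
    exact h1.trans_lt h2
  have hre0 : 0 < s.re := by linarith
  have harg : |Complex.arg s| ≤ |s.im| / s.re :=
    Literature.Probability.LatticeModels.PetersRegts.abs_arg_le_abs_im_div_re hre0
  have h3 : |Complex.arg s| * s.re ≤ |s.im| := (le_div_iff₀ hre0).1 harg
  have harg' : |Complex.arg s| ≤ 4 * ρ / 3 := by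
    have h4 : 0 ≤ |Complex.arg s| * (s.re - 3 / 4) :=
      mul_nonneg (abs_nonneg (Complex.arg s)) (by linarith)
    nlinarith [abs_nonneg (Complex.arg s), h4]
  -- D * |arg s| ≤ D * (4ρ/3) ≤ (4/3) * D / (4 (D+1)) ≤ 1/3 < π/2
  have hDρ : (D : ℝ) * ρ ≤ 1 / 4 := by
    have h1 : (D : ℝ) * ρ ≤ D * (1 / (4 * ((D : ℝ) + 1))) := mul_le_mul_of_nonneg_left hρ hD
    have h2 : (D : ℝ) * (1 / (4 * ((D : ℝ) + 1))) ≤ 1 / 4 := by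
      rw [mul_one_div, div_le_iff₀ hD1]
      nlinarith
    exact h1.trans h2
  calc (D : ℝ) * |Complex.arg s| ≤ D * (4 * ρ / 3) := mul_le_mul_of_nonneg_left harg' hD
    _ = (D * ρ) * (4 / 3) := by ring
    _ ≤ (1 / 4) * (4 / 3) := by gcongr
    _ ≤ π / 2 := by linarith [Real.pi_gt_three]

/-! ## The sector on the route's objects -/

/-- Every exponent `L(ω) = |ω| + 2 k_B(ω)` of a configuration `ω ⊆ E(Ω_δ)` is at most
`D_δ = |E(Ω_δ)| + 2 |V(Ω_δ)|` (a cluster count is at most the number of vertices). [folklore] -/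
theorem oddsCone_exponent_le (R : ConformalRectangle) {δ : ℝ} (hδ : 0 < δ)
    {ω : Set (Sym2 (Site 2))} (hω : ω ∈ 𝒫 (discreteDomainGraph R.carrier δ).edgeSet) :
    ω.ncard + 2 * Nat.card ((openGraph ω ⊔ wired (discreteArc R.carrier δ (R.arc 0) ∪
        discreteArc R.carrier δ (R.arc 2))).induce (meshDomain R.carrier δ)).ConnectedComponent
      ≤ (discreteDomainGraph R.carrier δ).edgeSet.ncard + 2 * (meshDomain R.carrier δ).ncard := by
  have hE := finite_edgeSet_discreteDomainGraph R.isBounded hδ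
  have hV := meshDomain_finite R.isBounded hδ
  have h1 : ω.ncard ≤ (discreteDomainGraph R.carrier δ).edgeSet.ncard :=
    Set.ncard_le_ncard ((Set.mem_powerset_iff _ _).1 hω) hE
  have h2 : Nat.card ((openGraph ω ⊔ wired (discreteArc R.carrier δ (R.arc 0) ∪
      discreteArc R.carrier δ (R.arc 2))).induce (meshDomain R.carrier δ)).ConnectedComponent
        ≤ (meshDomain R.carrier δ).ncard := by
    haveI : Finite (meshDomain R.carrier δ) := hV.to_subtype
    rw [← Nat.card_coe_set_eq]
    exact Nat.card_le_card_of_surjective _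
      (fun c => SimpleGraph.ConnectedComponent.ind (fun v => ⟨v, rfl⟩) c)
  omega

/-- **(E4) The crossing-odds cone in an explicit sector (the trivial mechanism and its rate).**
For every conformal rectangle `R`, mesh `δ > 0`, `κ ≥ 0` and every complex `s` within
`ρ_δ = 1 / (4 (D_δ + 1))`, `D_δ = |E(Ω_δ)| + 2|V(Ω_δ)|`, of the segment `[1, √2]`:
`Re((Z_δ(s) − N_δ(s)) · conj N_δ(s)) ≥ −κ ‖Z_δ(s) − N_δ(s)‖ ‖N_δ(s)‖` (indeed `≥ 0`).  The radius
`ρ_δ ≍ δ²` quantifies the pointwise envelope `oddsCone_pointwise`; the registered stub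
`stub_oddsCone` is exactly the assertion that `ρ_δ` can be replaced by a `δ`-independent `ρ`.
Stated with the stub's `let`s written out (its `dsimp only`-normal form). [folklore] -/
theorem oddsCone_sector : ∀ R : Literature.Probability.RandomPlanarGeometry.ConformalRectangle, ∀ δ : ℝ, 0 < δ → ∀ κ : ℝ, 0 ≤ κ → ∀ s ∈ Metric.thickening (1 / (4 * (((Literature.Probability.LatticeModels.discreteDomainGraph R.carrier δ).edgeSet.ncard : ℝ) + 2 * ((Literature.Probability.LatticeModels.meshDomain R.carrier δ).ncard : ℝ) + 1))) (((↑) : ℝ → ℂ) '' Set.Icc (1:ℝ) (Real.sqrt 2)), -(κ * (‖(∑ᶠ ω ∈ 𝒫 (Literature.Probability.LatticeModels.discreteDomainGraph R.carrier δ).edgeSet, s ^ (ω.ncard + 2 * Nat.card ((Literature.Probability.Percolation.openGraph ω ⊔ Literature.Probability.LatticeModels.wired (Literature.Probability.LatticeModels.discreteArc R.carrier δ (R.arc 0) ∪ Literature.Probability.LatticeModels.discreteArc R.carrier δ (R.arc 2))).induce (Literature.Probability.LatticeModels.meshDomain R.carrier δ)).ConnectedComponent)) - (∑ᶠ ω ∈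 𝒫 (Literature.Probability.LatticeModels.discreteDomainGraph R.carrier δ).edgeSet, (Literature.Probability.Percolation.discreteCrossing R.carrier δ (R.arc 0) (R.arc 2)).indicator (fun ω ↦ s ^ (ω.ncard + 2 * Nat.card ((Literature.Probability.Percolation.openGraph ω ⊔ Literature.Probability.LatticeModels.wired (Literature.Probability.LatticeModels.discreteArc R.carrier δ (R.arc 0) ∪ Literature.Probability.LatticeModels.discreteArc R.carrier δ (R.arc 2))).induce (Literature.Probability.LatticeModels.meshDomain R.carrier δ)).ConnectedComponent)) ω)‖ * ‖∑ᶠ ω ∈ 𝒫 (Literature.Probability.LatticeModels.discreteDomainGraph R.carrier δ).edgeSet, (Literature.Probability.Percolation.discreteCrossing R.carrier δ (R.arc 0) (R.arc 2)).indicator (fun ω ↦ s ^ (ω.ncard + 2 * Nat.card ((Literature.Probability.Percolation.openGraph ω ⊔ Literature.Probability.LatticeModels.wired (Literature.Probability.LatticeModels.discreteArc R.carrier δ (R.arc 0) ∪ Literature.Probability.LatticeModels.discreteArc R.carrier δ (R.arc 2))).induce (Literature.Probability.LatticeModels.meshDomain R.carrier δ)).ConnectedComponent)) ω‖)) ≤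 (((∑ᶠ ω ∈ 𝒫 (Literature.Probability.LatticeModels.discreteDomainGraph R.carrier δ).edgeSet, s ^ (ω.ncard + 2 * Nat.card ((Literature.Probability.Percolation.openGraph ω ⊔ Literature.Probability.LatticeModels.wired (Literature.Probability.LatticeModels.discreteArc R.carrier δ (R.arc 0) ∪ Literature.Probability.LatticeModels.discreteArc R.carrier δ (R.arc 2))).induce (Literature.Probability.LatticeModels.meshDomain R.carrier δ)).ConnectedComponent)) - (∑ᶠ ω ∈ 𝒫 (Literature.Probability.LatticeModels.discreteDomainGraph R.carrier δ).edgeSet, (Literature.Probability.Percolation.discreteCrossing R.carrier δ (R.arc 0) (R.arc 2)).indicator (fun ω ↦ s ^ (ω.ncard + 2 * Nat.card ((Literature.Probability.Percolation.openGraph ω ⊔ Literature.Probability.LatticeModels.wired (Literature.Probability.LatticeModels.discreteArc R.carrier δ (R.arc 0) ∪ Literature.Probability.LatticeModels.discreteArc R.carrier δ (R.arc 2))).induce (Literature.Probability.LatticeModels.meshDomain R.carrier δ)).ConnectedComponent)) ω)) * (starRingEnd ℂ) (∑ᶠ ω ∈ 𝒫 (Literature.Probability.LatticeModels.discreteDomainGraph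 R.carrier δ).edgeSet, (Literature.Probability.Percolation.discreteCrossing R.carrier δ (R.arc 0) (R.arc 2)).indicator (fun ω ↦ s ^ (ω.ncard + 2 * Nat.card ((Literature.Probability.Percolation.openGraph ω ⊔ Literature.Probability.LatticeModels.wired (Literature.Probability.LatticeModels.discreteArc R.carrier δ (R.arc 0) ∪ Literature.Probability.LatticeModels.discreteArc R.carrier δ (R.arc 2))).induce (Literature.Probability.LatticeModels.meshDomain R.carrier δ)).ConnectedComponent)) ω)).re := by
  intro R δ hδ κ hκ s hs
  have hfin := finite_powerset_edgeSet R.isBounded hδ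
  obtain ⟨z, ⟨t, ht, rfl⟩, hst⟩ := Metric.mem_thickening_iff.1 hs
  simp only [finsum_mem_eq_finite_toFinset_sum _ hfin]
  refine oddsCone_sector_finset hfin.toFinset _ _
    (D := (discreteDomainGraph R.carrier δ).edgeSet.ncard + 2 * (meshDomain R.carrier δ).ncard)
    (fun ω hω => oddsCone_exponent_le R hδ (hfin.mem_toFinset.1 hω)) hκ (le_of_eq ?_) ht.1 hst
  push_cast
  ring

end

end Summit.CriticalPhenomena.CardyFormulaZ2.Theorems.UniformZeroFree
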